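import Mathlib
import Summits.Ventures.HodgeRepro2.Tier7.Line3.CompactGroupSurjIntegral

/-!
# Tier7/Line3/TorusCircleReduction — the `U(1)²` torus is `Z · K` and its integrals reduce to `K` (seat t7-x1, gen 2;
row U1 of the t7-lead's RESIDUAL MAP, the model-level instantiation of `CompactGroupSurjIntegral`)

The diagonal torus of `U(1,1)` in coordinates is `T = Circle × Circle` (`(α, β) ↦ diag(α, β)`); its central part is
`Z = {(c, c)}` (the scalars) and its `SU(1,1)`-part is `K = {(u, u⁻¹)}`. This module instantiates the abstract reduction
`CompactGroupSurjIntegral.integral_eq_integral_of_invariant` on `T`: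
* `diagZ`, `antiK : Subgroup (Circle × Circle)` (the ranges of `c ↦ (c, c)` and `u ↦ (u, u⁻¹)`);
* `exists_sq_eq_circle`: square roots exist in `Circle`; hence `mul_surjective`: `Z · K = T`
  (`(α, β) = (c, c) · (u, u⁻¹)` with `c² = α β`, `u = α c⁻¹` — the 2-to-1 cover);
* **`integral_eq_integral_antiK`**: for continuous `F` with `F (c u, c u⁻¹) = F (u, u⁻¹)` (the `Z`-invariance: the
  central characters match), `∫_T F = ∫_K F` with Haar probability measures — row U1's «`vol(Z)` · the `SU(1,1)`
  bi-torus integral» on the model torus.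
Mathlib has no `MeasurableSpace Circle` instance (only `AddCircle`), so the Borel structure and the second countability of
`Circle` are DISPLAYED instance hypotheses (`[MeasurableSpace Circle] [BorelSpace Circle] [SecondCountableTopology Circle]`:
the Borel σ-algebra of the compact metric circle). Nothing here is about a representation, a test function or a period;
nothing about (N) or HC_CM; §8(d): NO. Blind lane: Mathlib + the HodgeRepro2 prefix only; no sorry;
axioms ⊆ {propext, Classical.choice, Quot.sound}.
-/

namespace Summit.Ventures.HodgeRepro2.Tier7.Line3.TorusCircleReduction

open MeasureTheory Summit.Ventures.HodgeRepro2.Tier7.Line3.CompactGroupSurjIntegral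

/-- the central part of the torus: the diagonal `{(c, c)}` -/
noncomputable def diagZ : Subgroup (Circle × Circle) := (MonoidHom.prod (MonoidHom.id Circle) (MonoidHom.id Circle)).range

/-- the `SU(1,1)`-part of the torus: the antidiagonal `{(u, u⁻¹)}` -/
noncomputable def antiK : Subgroup (Circle × Circle) := (MonoidHom.prod (MonoidHom.id Circle) invMonoidHom).range

/-- membership in `diagZ` -/
theorem mem_diagZ (p : Circle × Circle) : p ∈ diagZ ↔ ∃ c : Circle, (c, c) = p := by
  unfold diagZ
  rw [MonoidHom.mem_range]
  rfl

/-- membership in `antiK` -/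
theorem mem_antiK (p : Circle × Circle) : p ∈ antiK ↔ ∃ u : Circle, (u, u⁻¹) = p := by
  unfold antiK
  rw [MonoidHom.mem_range]
  rfl

/-- square roots exist on the circle. -/
theorem exists_sq_eq_circle (w : Circle) : ∃ c : Circle, c ^ 2 = w := by
  obtain ⟨z, hz⟩ : ∃ z : ℂ, z ^ 2 = (w : ℂ) :=
    ⟨(w : ℂ) ^ (((2 : ℕ) : ℂ)⁻¹), Complex.cpow_nat_inv_pow _ two_ne_zero⟩
  have hz1 : ‖z‖ = 1 := by
    have h : ‖z‖ ^ 2 = 1 := by rw [← norm_pow, hz, Circle.norm_coe]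
    have h0 : 0 ≤ ‖z‖ := norm_nonneg _
    nlinarith
  refine ⟨⟨z, mem_sphere_zero_iff_norm.2 hz1⟩, ?_⟩
  apply Circle.ext
  rw [Circle.coe_pow]
  exact hz

/-- **`Z · K = T`**: every `(α, β)` is `(c, c) · (u, u⁻¹)` (`c² = α β`, `u = α c⁻¹`). -/
theorem mul_surjective (t : Circle × Circle) : ∃ z ∈ diagZ, ∃ k ∈ antiK, z * k = t := by
  obtain ⟨α, β⟩ := t
  obtain ⟨c, hc⟩ := exists_sq_eq_circle (α * β)
  have hcc : c * c = α * β := by rw [← sq]; exact hc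
  refine ⟨(c, c), (mem_diagZ _).2 ⟨c, rfl⟩, (α * c⁻¹, (α * c⁻¹)⁻¹), (mem_antiK _).2 ⟨α * c⁻¹, rfl⟩, ?_⟩
  rw [Prod.mk_mul_mk]
  refine Prod.ext ?_ ?_
  · simp
  · show c * (α * c⁻¹)⁻¹ = β
    have h1 : c * (α * c⁻¹)⁻¹ = (c * c) * α⁻¹ := by
      rw [mul_inv, inv_inv]
      ac_rfl
    rw [h1, hcc, mul_inv_cancel_comm]

/-- the `Z`-invariance in the abstract form, from the coordinate form `F (c u, c u⁻¹) = F (u, u⁻¹)`. -/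
theorem invariant_of_coords (F : Circle × Circle → ℂ)
    (hinv : ∀ c u : Circle, F (c * u, c * u⁻¹) = F (u, u⁻¹)) :
    ∀ z ∈ diagZ, ∀ k ∈ antiK, F (z * k) = F k := by
  intro z hz k hk
  obtain ⟨c, rfl⟩ := (mem_diagZ z).1 hz
  obtain ⟨u, rfl⟩ := (mem_antiK k).1 hk
  exact hinv c u

/-- **ROW U1 on the model torus**: for continuous `F : T → ℂ` invariant under the centre (`F (c u, c u⁻¹) = F (u, u⁻¹)`),
`∫_T F = ∫_K F` with Haar probability measures on `T = Circle × Circle`, `Z` and `K`. -/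
theorem integral_eq_integral_antiK [MeasurableSpace Circle] [BorelSpace Circle] [SecondCountableTopology Circle]
    (ν : Measure (Circle × Circle)) [ν.IsHaarMeasure] [IsProbabilityMeasure ν]
    (μZ : Measure diagZ) [μZ.IsHaarMeasure] [IsProbabilityMeasure μZ]
    (μK : Measure antiK) [μK.IsHaarMeasure] [IsProbabilityMeasure μK]
    (F : Circle × Circle → ℂ) (hF : Continuous F)
    (hinv : ∀ c u : Circle, F (c * u, c * u⁻¹) = F (u, u⁻¹)) :
    ∫ t, F t ∂ν = ∫ k : antiK, F k ∂μK :=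
  integral_eq_integral_of_invariant diagZ antiK mul_surjective ν μZ μK F hF (invariant_of_coords F hinv)

end Summit.Ventures.HodgeRepro2.Tier7.Line3.TorusCircleReduction
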